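import Literature.AlgebraicGeometry.Hu2025.Statements.S04ModelV.R105aGoverning
import Mathlib.Algebra.MvPolynomial.CommRing
import HarnessLib

/-!
# Hu 2025 row 105 — the governing binomials of a block, listed (kernel; D-lane): `Eq4_46_ours` holds for every NONTRIVIAL
# coefficient ring and every model datum with `rel (head F) = F`

Support computation for the ℘-binomial `B = x̄_{t}·x_{(s)} − x̄_{s}·x_{(t)}` of two distinct terms: its two monomials have distinct
exponents (they differ at the ϱ-variables), so `B ≠ 0` over a nontrivial ring and the ϱ-variables occurring in `B` are exactly `x_{(s)}`,
`x_{(t)}` (`inr_mem_vars_wpBinomial_iff`). Hence the literal `𝓑^gov_F` is `{±B_{F,s} : s ∈ S_F ∖ s_F}` (`eq4_46_ours_of_nontrivial`). Set/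
support bookkeeping on the row-103/105 definitions only; nothing about the manuscript's mathematics is decided. AI-written; weaker than expert review.
-/

noncomputable section

namespace Literature.AlgebraicGeometry.Hu2025.Proofs.S04ModelV

open MvPolynomial Literature.AlgebraicGeometry.Hu2025.Statements.S04ModelV

universe u v w x

variable {k : Type u} [CommRing k] {σ : Type v} {T : Type w} {𝔗 : Type x}

/-- `x̄_a · x_{(b)}` is the monomial whose exponent is the chart monomial of `a` on the ϖ-side plus the ϱ-variable of `b`. [cite: Hu2025, §4.2.1 (4.8) / §4.5 (4.39)/(4.41)/(4.46), chunks p0022 l.10–21 / p0031 l.135–140, l.175–181 / p0032 l.9–24 (unrefereed preprint arXiv:2507.21400v1 under adjudication, D-0012/D-0089 — kernel support on OUR typed carriers of rows 103/105; nothing of the source asserted)] -/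
theorem toModel_img_mul_rhoVar (mono : T → (σ →₀ ℕ)) (a b : T) :
    toModel (k := k) (T := T) (img mono a) * rhoVar b = monomial ((((mono a).mapDomain Sum.inl + Finsupp.single (Sum.inr b) 1 : σ ⊕ T →₀ ℕ))) 1 := by
  simp only [toModel, img, rhoVar, rename_monomial, X, monomial_mul, mul_one]

/-- The ℘-binomial as a difference of two monomials. [cite: Hu2025, §4.2.1 (4.8) / §4.5 (4.39)/(4.41)/(4.46), chunks p0022 l.10–21 / p0031 l.135–140, l.175–181 / p0032 l.9–24 (unrefereed preprint arXiv:2507.21400v1 under adjudication, D-0012/D-0089 — kernel support on OUR typed carriers of rows 103/105; nothing of the source asserted)] -/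
theorem wpBinomial_eq (mono : T → (σ →₀ ℕ)) (s t : T) :
    wpBinomial (k := k) mono s t = monomial ((((mono t).mapDomain Sum.inl + Finsupp.single (Sum.inr s) 1 : σ ⊕ T →₀ ℕ))) 1 - monomial ((((mono s).mapDomain Sum.inl + Finsupp.single (Sum.inr t) 1 : σ ⊕ T →₀ ℕ))) 1 := by
  simp only [wpBinomial, toModel_img_mul_rhoVar]

/-- Value of the exponent of `x̄_a · x_{(b)}` at its own ϱ-index. [cite: Hu2025, §4.2.1 (4.8) / §4.5 (4.39)/(4.41)/(4.46), chunks p0022 l.10–21 / p0031 l.135–140, l.175–181 / p0032 l.9–24 (unrefereed preprint arXiv:2507.21400v1 under adjudication, D-0012/D-0089 — kernel support on OUR typed carriers of rows 103/105; nothing of the source asserted)] -/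
theorem wpExp_inr_self (mono : T → (σ →₀ ℕ)) (a b : T) : (((mono a).mapDomain Sum.inl + Finsupp.single (Sum.inr b) 1 : σ ⊕ T →₀ ℕ)) (Sum.inr b) = 1 := by
  simp only [Finsupp.coe_add, Pi.add_apply, Finsupp.single_eq_same]
  rw [Finsupp.mapDomain_notin_range _ _ (by simp), zero_add]

/-- Value of the exponent of `x̄_a · x_{(b)}` at another ϱ-index. [cite: Hu2025, §4.2.1 (4.8) / §4.5 (4.39)/(4.41)/(4.46), chunks p0022 l.10–21 / p0031 l.135–140, l.175–181 / p0032 l.9–24 (unrefereed preprint arXiv:2507.21400v1 under adjudication, D-0012/D-0089 — kernel support on OUR typed carriers of rows 103/105; nothing of the source asserted)] -/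
theorem wpExp_inr_of_ne (mono : T → (σ →₀ ℕ)) (a b : T) {r : T} (h : r ≠ b) : (((mono a).mapDomain Sum.inl + Finsupp.single (Sum.inr b) 1 : σ ⊕ T →₀ ℕ)) (Sum.inr r) = 0 := by
  simp only [Finsupp.coe_add, Pi.add_apply]
  rw [Finsupp.mapDomain_notin_range _ _ (by simp), zero_add, Finsupp.single_eq_of_ne]
  exact fun h' => h (Sum.inr_injective h')

/-- For distinct terms the two exponents differ. [cite: Hu2025, §4.2.1 (4.8) / §4.5 (4.39)/(4.41)/(4.46), chunks p0022 l.10–21 / p0031 l.135–140, l.175–181 / p0032 l.9–24 (unrefereed preprint arXiv:2507.21400v1 under adjudication, D-0012/D-0089 — kernel support on OUR typed carriers of rows 103/105; nothing of the source asserted)] -/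
theorem wpExp_ne (mono : T → (σ →₀ ℕ)) {s t : T} (hst : s ≠ t) : (((mono t).mapDomain Sum.inl + Finsupp.single (Sum.inr s) 1 : σ ⊕ T →₀ ℕ)) ≠ (((mono s).mapDomain Sum.inl + Finsupp.single (Sum.inr t) 1 : σ ⊕ T →₀ ℕ)) := by
  intro h
  have h1 := congrArg (fun d => d (Sum.inr s)) h
  simp only [wpExp_inr_self, wpExp_inr_of_ne mono s t hst] at h1
  exact one_ne_zero h1

/-- Support of the ℘-binomial of two distinct terms over a nontrivial ring: exactly its two monomials. [cite: Hu2025, §4.2.1 (4.8) / §4.5 (4.39)/(4.41)/(4.46), chunks p0022 l.10–21 / p0031 l.135–140, l.175–181 / p0032 l.9–24 (unrefereed preprint arXiv:2507.21400v1 under adjudication, D-0012/D-0089 — kernel support on OUR typed carriers of rows 103/105; nothing of the source asserted)] -/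
theorem mem_support_wpBinomial_iff [Nontrivial k] (mono : T → (σ →₀ ℕ)) {s t : T} (hst : s ≠ t)
    (d : σ ⊕ T →₀ ℕ) :
    d ∈ (wpBinomial (k := k) mono s t).support ↔ d = (((mono t).mapDomain Sum.inl + Finsupp.single (Sum.inr s) 1 : σ ⊕ T →₀ ℕ)) ∨ d = (((mono s).mapDomain Sum.inl + Finsupp.single (Sum.inr t) 1 : σ ⊕ T →₀ ℕ)) := by
  classical
  have hne := wpExp_ne mono hst
  rw [mem_support_iff, wpBinomial_eq, coeff_sub, coeff_monomial, coeff_monomial]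
  by_cases h1 : (((mono t).mapDomain Sum.inl + Finsupp.single (Sum.inr s) 1 : σ ⊕ T →₀ ℕ)) = d
  · subst h1; simp [hne.symm]
  · by_cases h2 : (((mono s).mapDomain Sum.inl + Finsupp.single (Sum.inr t) 1 : σ ⊕ T →₀ ℕ)) = d
    · subst h2; simp [hne]
    · simp only [if_neg h1, if_neg h2, sub_zero, ne_eq, not_true_eq_false, false_iff, not_or]
      exact ⟨fun h => h1 h.symm, fun h => h2 h.symm⟩

/-- Over a nontrivial ring the ℘-binomial of two distinct terms is non-zero. [cite: Hu2025, §4.2.1 (4.8) / §4.5 (4.39)/(4.41)/(4.46), chunks p0022 l.10–21 / p0031 l.135–140, l.175–181 / p0032 l.9–24 (unrefereed preprint arXiv:2507.21400v1 under adjudication, D-0012/D-0089 — kernel support on OUR typed carriers of rows 103/105; nothing of the source asserted)] -/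
theorem wpBinomial_ne_zero [Nontrivial k] (mono : T → (σ →₀ ℕ)) {s t : T} (hst : s ≠ t) :
    wpBinomial (k := k) mono s t ≠ 0 := by
  intro h
  have hmem : (((mono t).mapDomain Sum.inl + Finsupp.single (Sum.inr s) 1 : σ ⊕ T →₀ ℕ)) ∈ (wpBinomial (k := k) mono s t).support :=
    (mem_support_wpBinomial_iff mono hst _).mpr (Or.inl rfl)
  rw [h, support_zero] at hmem
  exact Finset.notMem_empty _ hmem

/-- **The ϱ-variables of a ℘-binomial**: for distinct terms `s ≠ t` over a nontrivial ring, `x_{(r)}` occurs in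
`x̄_t x_{(s)} − x̄_s x_{(t)}` iff `r = s` or `r = t`. [cite: Hu2025, §4.2.1 (4.8) / §4.5 (4.39)/(4.41)/(4.46), chunks p0022 l.10–21 / p0031 l.135–140, l.175–181 / p0032 l.9–24 (unrefereed preprint arXiv:2507.21400v1 under adjudication, D-0012/D-0089 — kernel support on OUR typed carriers of rows 103/105; nothing of the source asserted)] -/
theorem inr_mem_vars_wpBinomial_iff [Nontrivial k] (mono : T → (σ →₀ ℕ)) {s t : T} (hst : s ≠ t) (r : T) :
    (Sum.inr r : σ ⊕ T) ∈ (wpBinomial (k := k) mono s t).vars ↔ r = s ∨ r = t := by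
  rw [mem_vars_iff_mem_support]
  constructor
  · rintro ⟨d, hd, hr⟩
    rw [mem_support_wpBinomial_iff mono hst] at hd
    rw [Finsupp.mem_support_iff] at hr
    rcases hd with rfl | rfl
    · by_cases h : r = s
      · exact Or.inl h
      · exact absurd (wpExp_inr_of_ne mono t s h) hr
    · by_cases h : r = t
      · exact Or.inr h
      · exact absurd (wpExp_inr_of_ne mono s t h) hr
  · rintro (rfl | rfl)
    · exact ⟨(((mono t).mapDomain Sum.inl + Finsupp.single (Sum.inr r) 1 : σ ⊕ T →₀ ℕ)), (mem_support_wpBinomial_iff mono hst _).mpr (Or.inl rfl),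
        by rw [Finsupp.mem_support_iff, wpExp_inr_self]; exact one_ne_zero⟩
    · exact ⟨(((mono s).mapDomain Sum.inl + Finsupp.single (Sum.inr r) 1 : σ ⊕ T →₀ ℕ)), (mem_support_wpBinomial_iff mono hst _).mpr (Or.inr rfl),
        by rw [Finsupp.mem_support_iff, wpExp_inr_self]; exact one_ne_zero⟩

/-- `B_{(t,s)} = −B_{(s,t)}`. [cite: Hu2025, §4.2.1 (4.8) / §4.5 (4.39)/(4.41)/(4.46), chunks p0022 l.10–21 / p0031 l.135–140, l.175–181 / p0032 l.9–24 (unrefereed preprint arXiv:2507.21400v1 under adjudication, D-0012/D-0089 — kernel support on OUR typed carriers of rows 103/105; nothing of the source asserted)] -/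
theorem wpBinomial_swap (mono : T → (σ →₀ ℕ)) (s t : T) :
    wpBinomial (k := k) mono t s = -wpBinomial (k := k) mono s t := by
  rw [wpBinomial_eq, wpBinomial_eq, neg_sub]

/-- **`Eq4_46_ours` holds** over every NONTRIVIAL coefficient ring for every model datum whose `head` picks a term of its own
block (`rel (head F) = F`, as at the platform): the literal `𝓑^gov_F` is `{±B_{F,s} : s ∈ S_F ∖ s_F}`.
[cite: Hu2025, §4.2.1 (4.8) / §4.5 (4.39)/(4.41)/(4.46), chunks p0022 l.10–21 / p0031 l.135–140, l.175–181 / p0032 l.9–24 (unrefereed preprint arXiv:2507.21400v1 under adjudication, D-0012/D-0089 — kernel support on OUR typed carriers of rows 103/105; nothing of the source asserted)] -/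
theorem eq4_46_ours_of_nontrivial [Nontrivial k] (rel : T → 𝔗) (mono : T → (σ →₀ ℕ)) (head : 𝔗 → T)
    (hhead : ∀ F, rel (head F) = F) : Eq4_46_ours (k := k) (σ := σ) rel mono head := by
  intro F
  ext f
  simp only [Bgov, govBinomial, Set.mem_setOf_eq]
  constructor
  · rintro ⟨⟨a, b, hab, hne, haF, rfl, hb0⟩, -, hvars⟩
    have haF' : rel a = F := by simpa using haF
    rw [inr_mem_vars_wpBinomial_iff mono hne] at hvars
    rcases hvars with h | h
    · -- `head F = a`: `f = B_{(head F, b)} = −B_{F,b}`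
      subst h
      exact ⟨b, hab ▸ haF', fun hb => hne hb.symm, Or.inr (wpBinomial_swap mono b (head F))⟩
    · -- `head F = b`: `f = B_{(a, head F)} = B_{F,a}`
      subst h
      exact ⟨a, haF', hne, Or.inl rfl⟩
  · rintro ⟨s, hsF, hs, hf⟩
    have hmem : ∀ {a b : T}, rel a = F → rel b = F → a ≠ b →
        wpBinomial (k := k) mono a b ∈ wpBinomials (k := k) rel mono {F} := fun {a b} ha hb hab =>
      ⟨a, b, by rw [ha, hb], hab, by simpa using ha, rfl, wpBinomial_ne_zero mono hab⟩
    rcases hf with rfl | rfl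
    · refine ⟨hmem hsF (hhead F) hs, ⟨F, ?_⟩, ?_⟩
      · exact (inr_mem_vars_wpBinomial_iff mono hs _).mpr (Or.inr rfl)
      · exact (inr_mem_vars_wpBinomial_iff mono hs _).mpr (Or.inr rfl)
    · rw [← wpBinomial_swap]
      refine ⟨hmem (hhead F) hsF (Ne.symm hs), ⟨F, ?_⟩, ?_⟩
      · exact (inr_mem_vars_wpBinomial_iff mono (Ne.symm hs) _).mpr (Or.inl rfl)
      · exact (inr_mem_vars_wpBinomial_iff mono (Ne.symm hs) _).mpr (Or.inl rfl)

end Literature.AlgebraicGeometry.Hu2025.Proofs.S04ModelV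

end
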